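import Literature.AlgebraicGeometry.Motives.AbelianVarietyInducedActionMackey
import HarnessLib

/-!
# Mackey's decomposition of the fixed part of `Res_L Ind_H^G Y`, prime-free and up to isogeny:
# `|H| · |L| · dim B_L(Res_L Ind_H^G Y) = Σ_{x ∈ G} |H ∩ x⁻¹Lx| · dim B_{H ∩ x⁻¹Lx}(Y)` and
# `B_L(Res_L Ind_H^G Y)^{|H| |L|} ∼ ∏_{x ∈ G} B_{H ∩ x⁻¹Lx}(Y)^{|H ∩ x⁻¹Lx|}`

`X = ⊕_{t ∈ T} Y_t = Ind_H^G (Y, α)` is an induced action on a power of an abelian variety over a field `K` (bicone `b`,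
`Σ_t π_t ≫ ι_t = 𝟙`; `ρ : G → End X`, `ι_t ρ(g) π_u = 0` for `u ≠ g t`; `T` transitive, `H = Stab(t₀)`,
`α(h) = ι_{t₀} ρ(h) π_{t₀}`), `L ≤ G` a subgroup, `B_L(X) = Im N_L`, `N_L = Σ_{l ∈ L} ρ(l)`.  Serre's Prop. 22,
`Res_L Ind_H^G W ≅ ⊕_{s ∈ L\G/H} Ind_{H_s}^L W_s`, gives for the fixed parts `(Res_L Ind_H^G W)^L ≅ ⊕_s W_s^{H_s} ≅ ⊕_s W^{H ∩ s⁻¹Ls}`.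
The prequel (`Motives/AbelianVarietyInducedActionMackey`) proved the `ℓ`-adic form
`|H| |L| · 2 dim B_L(X) = Σ_{x ∈ G} Σ_{h ∈ H ∩ x⁻¹Lx} χ_Y(h)`; here the inner sums are identified PRIME-FREELY with the fixed
parts of the subgroups **`H_x = H ∩ x⁻¹Lx ≤ H`** (as a subgroup of `H = Stab(t₀)`:
`(L.comap (conj x)).subgroupOf (Stab t₀)`, membership `x h x⁻¹ ∈ L`) acting on `Y` through `α`, with norms
**`N_x = Σ_{h ∈ H, xhx⁻¹ ∈ L} α(h)`** (`hN`), `B_{H_x}(Y) = Im N_x` (theorems only, no definition):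

* §1 `N_x ≫ N_x = |H_x| • N_x`, `Tr(N_x | T_ℓ Y) = Σ_{h ∈ H, xhx⁻¹ ∈ L} Tr(α(h) | T_ℓ Y)` and its `Hom(−, B)` form;
* §2 **`|H| · |L| · dim B_L(Res_L Ind_H^G Y) = Σ_{x ∈ G} |H_x| · dim B_{H_x}(Y)`** (any field; each double coset `LxH`
  contributes `|LxH| · |H_x| dim B_{H_x}(Y) = |L| |H| dim B_{H_x}(Y)`, i.e. `dim B_L(X) = Σ_{s ∈ L\G/H} dim B_{H_s}(Y)`), and
  **`|H| · |L| · rk_ℤ Hom(B_L(X), B) = Σ_x |H_x| · rk_ℤ Hom(B_{H_x}(Y), B)`** for every abelian variety `B`;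
* §3 over a PERFECT field: **`B_L(Res_L Ind_H^G Y)^{|H| |L|} ∼ ∏_{x ∈ G} B_{H_x}(Y)^{|H_x|}`** (equal `Hom`-counts, the tree's
  `isIsogenous_iff_forall_finrank_hom_eq'`).

The cases `H ⊴ G, L = H` (`H_x = H`) and `H_x = 1` for all `x` of the prequel are the two extreme instances.

## References

* [SerreLinearRepresentations1977] J.-P. Serre, *Linear Representations of Finite Groups*, GTM 42 (1977): §7.3 Prop. 22
  (`Res_K Ind_H^G W ≅ ⊕_{s ∈ K\G/H} Ind_{H_s}^K W_s`, `H_s = sHs⁻¹ ∩ K`) and Remark, §7.2 Thm. 13, §3.3 Thm. 12.  Held: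
  `book:serre1977-linear-representations-finite-groups`, PDF pp. 50–54 read 2026-08-28.
* [KaniRosen1989] E. Kani, M. Rosen, *Idempotent relations and factors of Jacobians*, Math. Ann. 284 (1989), §2
  (`χ_B(ε)`), §3 Thm. B (`ε_H = |H|⁻¹ Σ_h h`, `B_H`).
* [LangeRodriguez2022] H. Lange, R. E. Rodríguez, *Decomposition of Jacobians by Prym Varieties*, LNM 2310 (2022), §2.9.1
  Prop. 2.9.3 (PDF p. 46), §3.5.
* [Milne1986AbelianVarieties] J. S. Milne, *Abelian Varieties* (1986), §12 (p. 122: Hom-counts and isogeny classes).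
* [MumfordAV1970] D. Mumford, *Abelian Varieties* (1970), §19 Thm. 3 (p. 176), Thm. 4 (p. 180).
-/

noncomputable section

open CategoryTheory CategoryTheory.Limits MulAction
open Literature.NumberTheory.DiophantineGeometry

universe u

namespace Literature.AlgebraicGeometry.Motives

namespace AbelianVariety

namespace Imprimitive

variable {K : Type u} [Field K]

/-! ## §1 The norms `N_x = Σ_{h ∈ H, xhx⁻¹ ∈ L} α(h)` of the subgroups `H_x = H ∩ x⁻¹Lx` -/

section Norms

variable (ℓ : ℕ) [Fact ℓ.Prime] {Y : AbelianVariety K} (B : AbelianVariety K) {T : Type} {G : Type} [Group G]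
  [MulAction G T] (t₀ : T) [Fintype (stabilizer G t₀)] (α : stabilizer G t₀ →* End Y) (L : Subgroup G)
  [DecidablePred (· ∈ L)] {N : G → (Y ⟶ Y)}
  (hN : ∀ x : G, End.of (N x) = ∑ h : stabilizer G t₀, if x * h * x⁻¹ ∈ L then α h else 0)

include hN

omit [Fact ℓ.Prime] in
/-- **`N_x ≫ N_x = |H_x| • N_x`**: `N_x = Σ_{h ∈ H, xhx⁻¹ ∈ L} α(h)` is the norm of the subgroup `H_x = H ∩ x⁻¹Lx` of `H = Stab(t₀)`
(realised as `(L.comap (conj x)).subgroupOf (Stab t₀)`, `h ∈ H_x ⟺ xhx⁻¹ ∈ L`) acting on `Y` through `α`, hence a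
quasi-idempotent with factor `|H_x|`. [cite: KaniRosen1989, §3 Thm. B (`ε_H`)] [cite: SerreLinearRepresentations1977, §7.3 Prop. 22 (`H_s = sHs⁻¹ ∩ K`)] -/
theorem normInter_comp_normInter_eq_natCard_nsmul (x : G) :
    N x ≫ N x = Nat.card ((L.comap (MulAut.conj x).toMonoidHom).subgroupOf (stabilizer G t₀)) • N x := by
  classical
  set Hx := (L.comap (MulAut.conj x).toMonoidHom).subgroupOf (stabilizer G t₀) with hHx
  have hmem : ∀ h : stabilizer G t₀, h ∈ Hx ↔ x * h * x⁻¹ ∈ L := fun h ↦ by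
    rw [hHx, Subgroup.mem_subgroupOf, Subgroup.mem_comap, MulEquiv.coe_toMonoidHom, MulAut.conj_apply]
  have hN' : End.of (N x) = ∑ k : Hx, α k := by
    rw [hN x, ← Finset.sum_filter]
    exact Finset.sum_subtype _ (fun h ↦ by rw [Finset.mem_filter, hmem]; simp) _
  rw [Nat.card_eq_fintype_card]
  exact norm_comp_norm_eq_card_nsmul α hN'

/-- **`Tr(N_x | T_ℓ Y) = Σ_{h ∈ H, xhx⁻¹ ∈ L} Tr(α(h) | T_ℓ Y)`** (additivity of `T_ℓ` and of the trace).
[cite: MumfordAV1970, §19 Thm. 3 (p. 176)] -/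
theorem trace_tateModuleMap_normInter_eq_sum (x : G) :
    LinearMap.trace ℤ_[ℓ] (Y.tateModule ℓ) (tateModuleMap ℓ (N x)) =
      ∑ h : stabilizer G t₀, (if x * h * x⁻¹ ∈ L then
        LinearMap.trace ℤ_[ℓ] (Y.tateModule ℓ) (tateModuleMap ℓ (End.asHom (α h))) else 0) := by
  have h : N x = ∑ h : stabilizer G t₀, (if x * h * x⁻¹ ∈ L then End.asHom (α h) else 0) := hN x
  rw [h, tateModuleMap_sum, map_sum]
  exact Finset.sum_congr rfl fun k _ ↦ by split_ifs <;> simp [tateModuleMap_zero]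

omit [Fact ℓ.Prime] in
/-- **`χ_B(N_x) = Σ_{h ∈ H, xhx⁻¹ ∈ L} χ_B(α(h))`** on `Hom(−, B)` (any field). [cite: KaniRosen1989, §2] [cite: MumfordAV1970, §19 Thm. 3 (p. 176)] -/
theorem trace_leftComp_normInter_eq_sum (x : G) :
    LinearMap.trace ℤ (Y ⟶ B) (Preadditive.leftComp B (N x)).toIntLinearMap =
      ∑ h : stabilizer G t₀, (if x * h * x⁻¹ ∈ L then
        LinearMap.trace ℤ (Y ⟶ B) (Preadditive.leftComp B (End.asHom (α h))).toIntLinearMap else 0) := by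
  have h : N x = ∑ h : stabilizer G t₀, (if x * h * x⁻¹ ∈ L then (1 : ℤ) else 0) • End.asHom (α h) := by
    have h0 : N x = ∑ h : stabilizer G t₀, (if x * h * x⁻¹ ∈ L then End.asHom (α h) else 0) := hN x
    rw [h0]
    exact Finset.sum_congr rfl fun k _ ↦ by split_ifs <;> simp
  rw [h, trace_leftComp_sum_zsmul]
  exact Finset.sum_congr rfl fun k _ ↦ by split_ifs <;> simp

end Norms

/-! ## §2 `|H| · |L| · dim B_L(Res_L Ind_H^G Y) = Σ_{x ∈ G} |H_x| · dim B_{H_x}(Y)` and its `Hom(−, B)` form -/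

section FixedPart

variable {Y : AbelianVariety K} (B : AbelianVariety K) {T : Type} [Fintype T] (b : Bicone (fun _ : T ↦ Y))
  {G : Type} [Group G] [Fintype G] [MulAction G T] [IsPretransitive G T] (ρ : G →* End b.pt) (t₀ : T)
  [Fintype (stabilizer G t₀)] (α : stabilizer G t₀ →* End Y) (L : Subgroup G) [Fintype L] [DecidablePred (· ∈ L)]
  {N : G → (Y ⟶ Y)}
  (hN : ∀ x : G, End.of (N x) = ∑ h : stabilizer G t₀, if x * h * x⁻¹ ∈ L then α h else 0)

include hN

/-- **Mackey's fixed-part formula, prime-free: `|H| · |L| · dim B_L(Res_L Ind_H^G Y) = Σ_{x ∈ G} |H_x| · dim B_{H_x}(Y)`** with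
`H_x = H ∩ x⁻¹Lx`, `B_{H_x}(Y) = Im N_x`, `N_x = Σ_{h ∈ H_x} α(h)`, `B_L(X) = Im N_L` (any field; `T` transitive, `H = Stab(t₀)`,
`α(h) = ι_{t₀} ρ(h) π_{t₀}`): the prequel's `|H| |L| · 2 dim B_L(X) = Σ_x Σ_{h ∈ H_x} χ_Y(h)` for an auxiliary prime `ℓ`
invertible in `K`, and `Σ_{h ∈ H_x} χ_Y(h) = Tr(N_x) = |H_x| · 2 dim Im N_x`.  Grouping `x` by double cosets `LxH`
(`|LxH| = |L| |H| / |H_x|`) this is `dim B_L(X) = Σ_{s ∈ L\G/H} dim B_{H_s}(Y)` — "`(Res_L Ind_H^G W)^L = ⊕_s W_s^{H_s}`".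
[cite: SerreLinearRepresentations1977, §7.3 Prop. 22 and Remark] [cite: KaniRosen1989, §3 Thm. B] [cite: LangeRodriguez2022, §2.9.1 Prop. 2.9.3 (PDF p. 46)] -/
theorem card_mul_card_mul_dim_image_norm_eq_sum_natCard_mul_dim (hb : ∑ t, b.π t ≫ b.ι t = 𝟙 b.pt)
    (hρ : ∀ (g : G) (t u : T), g • t ≠ u → b.ι t ≫ End.asHom (ρ g) ≫ b.π u = 0)
    (hα : ∀ h : stabilizer G t₀, End.asHom (α h) = b.ι t₀ ≫ End.asHom (ρ h) ≫ b.π t₀)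
    {NL : b.pt ⟶ b.pt} (hNL : End.of NL = ∑ l : L, ρ l) :
    Fintype.card (stabilizer G t₀) * Fintype.card L * (image NL).dim =
      ∑ x : G, Nat.card ((L.comap (MulAut.conj x).toMonoidHom).subgroupOf (stabilizer G t₀)) * (image (N x)).dim := by
  obtain ⟨ℓ', hℓ'p, hℓ'⟩ := exists_prime_natCast_ne_zero (K := K)
  haveI : Fact ℓ'.Prime := ⟨hℓ'p⟩
  have h1 := card_stabilizer_mul_card_mul_two_mul_dim_image_norm_eq_sum ℓ' b ρ t₀ α L hb hρ hℓ' hα hNL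
  have h2 : ∀ x : G, ∑ h : stabilizer G t₀, (if x * h * x⁻¹ ∈ L then
      LinearMap.trace ℤ_[ℓ'] (Y.tateModule ℓ') (tateModuleMap ℓ' (End.asHom (α h))) else 0) =
      ((Nat.card ((L.comap (MulAut.conj x).toMonoidHom).subgroupOf (stabilizer G t₀)) * (2 * (image (N x)).dim) : ℕ) :
        ℤ_[ℓ']) := fun x ↦ by
    rw [← trace_tateModuleMap_normInter_eq_sum ℓ' t₀ α L hN x,
      trace_tateModuleMap_eq_mul_two_mul_dim ℓ' (normInter_comp_normInter_eq_natCard_nsmul t₀ α L hN x) hℓ']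
  rw [Finset.sum_congr rfl fun x _ ↦ h2 x, ← Nat.cast_sum] at h1
  have h3 := Nat.cast_injective (R := ℤ_[ℓ']) h1
  refine Nat.eq_of_mul_eq_mul_left zero_lt_two ?_
  calc 2 * (Fintype.card (stabilizer G t₀) * Fintype.card L * (image NL).dim)
      = Fintype.card (stabilizer G t₀) * (Fintype.card L * (2 * (image NL).dim)) := by ring
    _ = ∑ x : G, Nat.card ((L.comap (MulAut.conj x).toMonoidHom).subgroupOf (stabilizer G t₀)) *
          (2 * (image (N x)).dim) := h3
    _ = 2 * ∑ x : G, Nat.card ((L.comap (MulAut.conj x).toMonoidHom).subgroupOf (stabilizer G t₀)) *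
          (image (N x)).dim := by
        rw [Finset.mul_sum]
        exact Finset.sum_congr rfl fun x _ ↦ by ring

/-- **`|H| · |L| · rk_ℤ Hom(B_L(Res_L Ind_H^G Y), B) = Σ_{x ∈ G} |H_x| · rk_ℤ Hom(B_{H_x}(Y), B)`** for every abelian variety `B`
(any field; `χ_B(N_x) = |H_x| · rk Hom(Im N_x, B)` since `N_x² = |H_x| N_x`, and the prequel's `Hom`-side fixed-part formula).
[cite: SerreLinearRepresentations1977, §7.3 Prop. 22] [cite: KaniRosen1989, §2 and §3 Thm. B] -/
theorem card_mul_card_mul_finrank_hom_image_norm_eq_sum_natCard_mul_finrank (hb : ∑ t, b.π t ≫ b.ι t = 𝟙 b.pt)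
    (hρ : ∀ (g : G) (t u : T), g • t ≠ u → b.ι t ≫ End.asHom (ρ g) ≫ b.π u = 0)
    (hα : ∀ h : stabilizer G t₀, End.asHom (α h) = b.ι t₀ ≫ End.asHom (ρ h) ≫ b.π t₀)
    {NL : b.pt ⟶ b.pt} (hNL : End.of NL = ∑ l : L, ρ l) :
    Fintype.card (stabilizer G t₀) * Fintype.card L * Module.finrank ℤ (image NL ⟶ B) =
      ∑ x : G, Nat.card ((L.comap (MulAut.conj x).toMonoidHom).subgroupOf (stabilizer G t₀)) *
        Module.finrank ℤ (image (N x) ⟶ B) := by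
  have h1 := card_stabilizer_mul_card_mul_finrank_hom_image_norm_eq_sum B b ρ t₀ α L hb hρ hα hNL
  have h2 : ∀ x : G, ∑ h : stabilizer G t₀, (if x * h * x⁻¹ ∈ L then
      LinearMap.trace ℤ (Y ⟶ B) (Preadditive.leftComp B (End.asHom (α h))).toIntLinearMap else 0) =
      ((Nat.card ((L.comap (MulAut.conj x).toMonoidHom).subgroupOf (stabilizer G t₀)) *
        Module.finrank ℤ (image (N x) ⟶ B) : ℕ) : ℤ) := fun x ↦ by
    rw [← trace_leftComp_normInter_eq_sum B t₀ α L hN x,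
      trace_leftComp_eq_mul_finrank B (normInter_comp_normInter_eq_natCard_nsmul t₀ α L hN x), Nat.cast_mul]
  rw [Finset.sum_congr rfl fun x _ ↦ h2 x, ← Nat.cast_sum] at h1
  have h3 := Nat.cast_injective (R := ℤ) h1
  rw [← h3]
  ring

end FixedPart

/-! ## §3 `B_L(Res_L Ind_H^G Y)^{|H| |L|} ∼ ∏_{x ∈ G} B_{H_x}(Y)^{|H_x|}` over a perfect field -/

section Isogeny

variable [PerfectField K] {Y : AbelianVariety K} {T : Type} [Fintype T] (b : Bicone (fun _ : T ↦ Y))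
  {G : Type} [Group G] [Fintype G] [DecidableEq G] [MulAction G T] [IsPretransitive G T] (ρ : G →* End b.pt) (t₀ : T)
  [Fintype (stabilizer G t₀)] (α : stabilizer G t₀ →* End Y) (L : Subgroup G) [Fintype L] [DecidablePred (· ∈ L)]
  {N : G → (Y ⟶ Y)}
  (hN : ∀ x : G, End.of (N x) = ∑ h : stabilizer G t₀, if x * h * x⁻¹ ∈ L then α h else 0)

include hN

/-- **Mackey's decomposition of the fixed part up to isogeny: `B_L(Res_L Ind_H^G Y)^{|H| |L|} ∼ ∏_{x ∈ G} B_{H_x}(Y)^{|H_x|}`**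
over a perfect field (`H_x = H ∩ x⁻¹Lx`, `B_{H_x}(Y) = Im Σ_{h ∈ H_x} α(h)`; grouping by double cosets,
`B_L(X) ∼ ∏_{s ∈ L\G/H} B_{H_s}(Y)` — "`(Res_L Ind_H^G W)^L ≅ ⊕_{s} W^{H ∩ s⁻¹Ls}`"): both sides have the same
`rk Hom(−, B)` for every `B` (§2). [cite: SerreLinearRepresentations1977, §7.3 Prop. 22] [cite: KaniRosen1989, §3 Thm. B]
[cite: Milne1986AbelianVarieties, §12 p. 122] -/
theorem isIsogenous_biproduct_image_norm_biproduct_image_normInter (hb : ∑ t, b.π t ≫ b.ι t = 𝟙 b.pt)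
    (hρ : ∀ (g : G) (t u : T), g • t ≠ u → b.ι t ≫ End.asHom (ρ g) ≫ b.π u = 0)
    (hα : ∀ h : stabilizer G t₀, End.asHom (α h) = b.ι t₀ ≫ End.asHom (ρ h) ≫ b.π t₀)
    {NL : b.pt ⟶ b.pt} (hNL : End.of NL = ∑ l : L, ρ l) :
    IsIsogenous (⨁ fun _ : Fin (Fintype.card (stabilizer G t₀) * Fintype.card L) ↦ image NL)
      (⨁ fun x : G ↦ ⨁ fun _ : Fin (Nat.card ((L.comap (MulAut.conj x).toMonoidHom).subgroupOf (stabilizer G t₀))) ↦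
        image (N x)) := by
  refine isIsogenous_iff_forall_finrank_hom_eq'.2 fun B ↦ ?_
  rw [finrank_hom_biproduct_const, Fintype.card_fin,
    card_mul_card_mul_finrank_hom_image_norm_eq_sum_natCard_mul_finrank B b ρ t₀ α L hN hb hρ hα hNL,
    finrank_hom_biproduct]
  exact Finset.sum_congr rfl fun x _ ↦ by rw [finrank_hom_biproduct_const, Fintype.card_fin]

end Isogeny

end Imprimitive

end AbelianVariety

end Literature.AlgebraicGeometry.Motives
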